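import Summits.MatrixMultiplication.MatrixMultiplication.Theses.EPRFaces
import Summits.MatrixMultiplication.MatrixMultiplication.Theses.LongBlockAmortisation
import Literature.Computability.AlgebraicComplexity.FlatteningBound
import Summits.MatrixMultiplication.MatrixMultiplication.Theorems.EPRFacesFaceMaximiserStubConvexLift

/-!
# Birth skeleton (BC3) for crux `FaceMaximiser` (B) — stmt-MatrixMultiplication-10894

Route `route-MatrixMultiplication-EPRFaces` (rank 3; the crux is shared verbatim with route
`LongBlockAmortisation`, rank 3).  The crux, in rank form (`R` = tensor rank, `ω = omega ℂ`):

  `B : ∀ k ≥ 1, ∀ β, R(⟨n, n, n^k⟩) = O(n^β) → ω + (k − 1) ≤ β`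

i.e. `ω(1,1,k) = ω + k − 1` for every `k ≥ 1`: the product of an `n × n` matrix with an
`n × n^k` matrix admits no asymptotic economy over `n^{k−1}` independent square products; in
Strassen's chart of the spectrum of matrix shapes, some `ω`-maximising universal spectral point
lies on the EPR face `l₃ = 1` (support `SpectralFaceForm`, proved in the tree).

LINE `birth` (the route's own foreseen split "FaceMaximiser ⇐ the k = 2 instance; glue:
convexity", EPRFaces header, TWO-LAYER PLAN).  The sequence `k ↦ ω(1,1,k)` is CONVEX
(Lotti–Romani 1983 §1–2; tree: `omegaRect_convexOn_one_one`, from the Kronecker factorisation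
`⟨n^{k−1}, n^{k−1}, n^{2(k−1)}⟩ = ⟨n,n,n⟩^{⊗(k−2)} ⊗ ⟨n,n,n^k⟩` plus padding), it starts at
`ω(1,1,1) = ω` and is capped by blocking, `ω(1,1,k) ≤ ω + k − 1`.  A convex sequence under a
line of slope 1 through its first point that TOUCHES the line at `k = 2` equals the line
everywhere: so B for all `k` is exactly B at `k = 2`, `ω(1,1,2) = ω + 1` — "multiplying an
`n × n` matrix by an `n × n²` matrix is asymptotically as expensive as `n` square products".

STUBS (two registered; LEAD STATUS 2026-08-17, lead c1: `stub_convexLift` CLOSED — landed as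
`Summit.MatrixMultiplication.MatrixMultiplication.Theorems.stub_convexLift` (p147325) and imported
below; `stub_faceAtTwo` OPEN — the only `sorry` left — and CERTIFIED SUMMIT-EQUIVALENT: it is B in
normal form (`faceMaximiser_iff_faceAtTwo`, `Theorems/EPRFacesFaceMaximiserNormalForm.lean`,
p149667) and, E = PerfectAmortisation having LANDED (stmt-10893 closed 2026-08-17,
`Theorems/ShapeSubmodularityPerfectAmortisation.lean`, `PerfectAmortisation.perfectAmortisation_proof`,
p149012), UNCONDITIONALLY equivalent to the summit:
`EPRFacesFaceMaximiser.faceAtTwo_iff_summit : (stub statement) ↔ MatrixMultiplication` and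
`faceMaximiser_iff_summit : FaceMaximiser ↔ MatrixMultiplication`
(`Theorems/EPRFacesFaceMaximiserSummitEquivalence.lean`, p152501).  Filling this `sorry` is
proving `ω(ℂ) = 2`; no stub work strictly weaker than the summit can do it):
* `stub_faceAtTwo` — B at `k = 2` in rank form: every `β` with `R(⟨n,n,n²⟩) = O(n^β)` has
  `ω + 1 ≤ β`.  LOAD-BEARING and open; HONEST STATUS (certified in the tree, p152501):
  equivalent to B itself by the tree's convexity (this file proves ⇐, instantiation gives ⇒) and —
  E = `PerfectAmortisation` being PROVED in the tree (p149012; Coppersmith 1982 / first-power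
  `CW_q` laser, `q = k+2 → ∞`) — equivalent to `ω(ℂ) = 2` (route `closes` + `Converse`):
  `faceAtTwo_iff_summit`, `faceAtTwo_iff_omega_two`.  It is the crux in NORMAL FORM (one shape,
  `⟨n,n,n²⟩`; one tensor, `R̃(⟨2,2,4⟩) = 2·R̃(⟨2,2,2⟩)`), not a difficulty split, and the crux is
  the summit: B is atomic relative to everything in the tree and in print.
* `stub_convexLift` — three-point log-convexity of the rectangular rank exponents at the integer
  nodes `1 < 2 ≤ k`, in rank form and WITHOUT ε-loss: if `β` is admissible for `⟨n,n,n^k⟩` and `γ`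
  for `⟨n,n,n⟩` then `((k−2)γ + β)/(k−1)` is admissible for `⟨n,n,n²⟩` (Lotti–Romani 1983 §1
  p. 173: subadditivity + homogeneity; tree: `convexComb_mem_rectAdmissibleExponents_one_one`
  with `x = k, y = 1, a = 1/(k−1), b = (k−2)/(k−1)` after the `rectDim_natCast` / `rectDim_one`
  reindexing).  Size S/M, provable now.
ASSEMBLY (sorry-free, ~45 lines): `FaceMaximiser_of : stub₁-sig → stub₂-sig → <crux term>` (the
mathematics; conclusion = the crux statement verbatim, definitionally both route decls),
`FaceMaximiser_proof : EPRFaces.FaceMaximiser` (the registered conclusion, hypothesis-free, from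
the two stubs) and `FaceMaximiser_proof_longBlockAmortisation` (the sharing route's decl, same
term).  `k = 1` is the definition of `ω` as an infimum
(`csInf_le`, `admissibleExponents_bddBelow`); for `k ≥ 2` pick an admissible `γ < ω + ε/(k−1)`
(`exists_lt_of_csInf_lt`), lift to `⟨n,n,n²⟩`, apply the `k = 2` face bound and let `ε → 0`:
`(ω+1)(k−1) ≤ (k−2)γ + β < (k−2)ω + ε + β`, i.e. `ω + k − 1 < β + ε`.

DISPROOF USED: none — no `Disproof.lean` is registered for this crux (`ledger crux ls
stmt-MatrixMultiplication-10894`: no workfiles, 2026-08-17); no dead lines; the negatives index of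
the summit (STPP / design side) does not meet this line.  TENSION recorded on the item (support
`Dichotomy`, proved): B with the VXXZ2024 row `ω(1,1,3) ≤ 4.198809` forces `ω ≤ 2.198809`, so
`stub_faceAtTwo` is false as soon as `ω > 2.1989`.
-/

namespace Summit.MatrixMultiplication.MatrixMultiplication.Cruxes.FaceMaximiser.Birth

open Literature.Computability.AlgebraicComplexity
open Filter Asymptotics

/-- **Stub 1 (the face bound at `k = 2`, load-bearing).**  Every real `β` with
`R(⟨n, n, n²⟩) = O(n^β)` satisfies `ω + 1 ≤ β`; equivalently `ω(1,1,2) = ω + 1`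
(`≤` is blocking, `omegaRect_one_one_le_add`), equivalently `R̃(⟨2,2,4⟩) = 2^{ω+1} = 2·R̃(⟨2,2,2⟩)`
(`asymptoticRank_matMulTensor_rect`): gluing two copies of `⟨n,n,n⟩` along the shared left factor
saves nothing asymptotically.  Chart form: an `ω`-maximising universal spectral point on the EPR
face `l₃ = 1` (`SpectralFaceForm`).  Open — and EQUIVALENT TO THE SUMMIT `ω(ℂ) = 2`
(`EPRFacesFaceMaximiser.faceAtTwo_iff_summit` / `faceAtTwo_iff_omega_two`,
`Theorems/EPRFacesFaceMaximiserSummitEquivalence.lean`, p152501: `←` is `Converse`, `→` is the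
convexity lift + `EPRFaces.closes` with E = `perfectAmortisation_proof`, p149012).  A proof of this
stub is a proof of `ω(ℂ) = 2`; a refutation is a proof of `ω(ℂ) > 2`. -/
theorem stub_faceAtTwo :
    ∀ β : ℝ,
      ((fun n : ℕ => (tensorRank (matMulTensor ℂ n n (n ^ 2)) : ℝ)) =O[atTop]
        fun n : ℕ => (n : ℝ) ^ β) →
      omega ℂ + 1 ≤ β := by
  sorry

/-- **Stub 2 (convexity lift, Lotti–Romani three-point inequality at the nodes `1, 2, k`).**
For `k ≥ 2`: if `R(⟨n,n,n^k⟩) = O(n^β)` and `R(⟨n,n,n⟩) = O(n^γ)` then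
`R(⟨n,n,n²⟩) = O(n^{((k−2)γ+β)/(k−1)})` — since `2 = (1/(k−1))·k + ((k−2)/(k−1))·1` and
`⟨m₁m₂, m₁m₂, m₁^k m₂⟩ = ⟨m₁,m₁,m₁^k⟩ ⊗ ⟨m₂,m₂,m₂⟩` with `m₁ = ⌈n^{1/(k−1)}⌉`,
`m₂ = ⌈n^{(k−2)/(k−1)}⌉` (Kronecker submultiplicativity + padding; in `omegaRect` language
`(k−1)·ω(1,1,2) ≤ ω(1,1,k) + (k−2)·ω(1,1,1)`). [LottiRomani1983 §1; tree:
`convexComb_mem_rectAdmissibleExponents_one_one`, `rectDim_natCast`, `rectDim_one`] -/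
theorem stub_convexLift :
    ∀ k : ℕ, 2 ≤ k → ∀ β γ : ℝ,
      ((fun n : ℕ => (tensorRank (matMulTensor ℂ n n (n ^ k)) : ℝ)) =O[atTop]
        fun n : ℕ => (n : ℝ) ^ β) →
      ((fun n : ℕ => (tensorRank (matMulTensor ℂ n n n) : ℝ)) =O[atTop]
        fun n : ℕ => (n : ℝ) ^ γ) →
      ((fun n : ℕ => (tensorRank (matMulTensor ℂ n n (n ^ 2)) : ℝ)) =O[atTop]
        fun n : ℕ => (n : ℝ) ^ ((((k : ℝ) - 2) * γ + β) / ((k : ℝ) - 1))) :=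
  -- LANDED (p147325): `Theorems/EPRFacesFaceMaximiserStubConvexLift.lean`
  Summit.MatrixMultiplication.MatrixMultiplication.Theorems.stub_convexLift

/-! ## Assembly (sorry-free) -/

/-- **Assembly** `FaceMaximiser_of : <stub₁-sig> → <stub₂-sig> → FaceMaximiser` (sorry-free):
the two stub statements imply the crux — stated as the crux TERM verbatim (the common body of
`EPRFaces.FaceMaximiser` and `LongBlockAmortisation.FaceMaximiser`; both named decls are then
concluded from it by `rfl`-unfolding in `FaceMaximiser_proof` / `…_longBlockAmortisation`, which
are the hypothesis-free theorems the h21 skeleton audit registers).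
`k = 1`: `ω = inf (admissible exponents) ≤ β`.  `k ≥ 2`: for `ε > 0` choose an admissible
`γ < ω + ε/(k−1)` for `⟨n,n,n⟩`, lift `(β, γ)` to the admissible exponent `((k−2)γ+β)/(k−1)` of
`⟨n,n,n²⟩`, apply the face bound at `k = 2` and let `ε → 0`. -/
theorem FaceMaximiser_of
    (hface : ∀ β : ℝ,
      ((fun n : ℕ => (tensorRank (matMulTensor ℂ n n (n ^ 2)) : ℝ)) =O[atTop]
        fun n : ℕ => (n : ℝ) ^ β) →
      omega ℂ + 1 ≤ β)
    (hlift : ∀ k : ℕ, 2 ≤ k → ∀ β γ : ℝ,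
      ((fun n : ℕ => (tensorRank (matMulTensor ℂ n n (n ^ k)) : ℝ)) =O[atTop]
        fun n : ℕ => (n : ℝ) ^ β) →
      ((fun n : ℕ => (tensorRank (matMulTensor ℂ n n n) : ℝ)) =O[atTop]
        fun n : ℕ => (n : ℝ) ^ γ) →
      ((fun n : ℕ => (tensorRank (matMulTensor ℂ n n (n ^ 2)) : ℝ)) =O[atTop]
        fun n : ℕ => (n : ℝ) ^ ((((k : ℝ) - 2) * γ + β) / ((k : ℝ) - 1)))) :
    ∀ k : ℕ, 1 ≤ k → ∀ β : ℝ,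
      ((fun n : ℕ => (tensorRank (matMulTensor ℂ n n (n ^ k)) : ℝ)) =O[atTop]
        fun n : ℕ => (n : ℝ) ^ β) →
      omega ℂ + ((k : ℝ) - 1) ≤ β := by
  intro k hk β hβ
  rcases Nat.lt_or_ge k 2 with hk2 | hk2
  · -- `k = 1`: `β` is an admissible exponent of `⟨n,n,n⟩`, and `ω` is their infimum.
    obtain rfl : k = 1 := by omega
    have hfun : (fun n : ℕ => (tensorRank (matMulTensor ℂ n n (n ^ 1)) : ℝ)) =
        fun n : ℕ => (tensorRank (matMulTensor ℂ n n n) : ℝ) :=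
      funext fun n => by rw [tensorRank_matMulTensor_congr ℂ rfl rfl (pow_one n)]
    have hmem : β ∈ admissibleExponents ℂ := by
      rw [hfun] at hβ
      exact hβ
    have hle : omega ℂ ≤ β := csInf_le (admissibleExponents_bddBelow ℂ) hmem
    norm_num
    exact hle
  · -- `k ≥ 2`: lift to `⟨n,n,n²⟩` and use the face bound there.
    have hk2' : (2 : ℝ) ≤ (k : ℝ) := by exact_mod_cast hk2
    have hpos : (0 : ℝ) < (k : ℝ) - 1 := by linarith
    have hnn : (0 : ℝ) ≤ (k : ℝ) - 2 := by linarith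
    refine le_of_forall_pos_lt_add fun ε hε => ?_
    -- an admissible exponent `γ` of `⟨n,n,n⟩` with `γ < ω + ε/(k-1)`
    obtain ⟨γ, hγ, hγlt⟩ := exists_lt_of_csInf_lt (admissibleExponents_nonempty ℂ)
      (lt_add_of_pos_right (sInf (admissibleExponents ℂ)) (div_pos hε hpos))
    have hγO : (fun n : ℕ => (tensorRank (matMulTensor ℂ n n n) : ℝ)) =O[atTop]
        fun n : ℕ => (n : ℝ) ^ γ := hγ
    -- lift, then apply the `k = 2` face bound
    have h := hface _ (hlift k hk2 β γ hβ hγO)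
    rw [le_div_iff₀ hpos] at h
    -- `(ω + 1)(k - 1) ≤ (k - 2) γ + β` with `γ < ω + ε/(k-1)`
    have hω : sInf (admissibleExponents ℂ) = omega ℂ := rfl
    rw [hω] at hγlt
    have h1 : ((k : ℝ) - 2) * γ ≤ ((k : ℝ) - 2) * (omega ℂ + ε / ((k : ℝ) - 1)) :=
      mul_le_mul_of_nonneg_left hγlt.le hnn
    have h2 : ((k : ℝ) - 2) * (ε / ((k : ℝ) - 1)) < ε := by
      rw [mul_div_assoc', div_lt_iff₀ hpos]
      nlinarith
    nlinarith [h, h1, h2]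

/-- **Registered skeleton conclusion** (h21 skeleton format: the FIRST theorem concluding the
crux by name, no hypotheses, `sorry` only via the declared stubs): the item's primary decl
`EPRFaces.FaceMaximiser` (route EPRFaces, rank 3) from the two stubs.  The only `sorry`s of the
file sit inside `stub_faceAtTwo` and `stub_convexLift`. -/
theorem FaceMaximiser_proof :
    Summit.MatrixMultiplication.MatrixMultiplication.Theses.EPRFaces.FaceMaximiser :=
  FaceMaximiser_of stub_faceAtTwo stub_convexLift

/-- The same conclusion under the sharing route's name `LongBlockAmortisation.FaceMaximiser`
(route-MatrixMultiplication-LongBlockAmortisation, rank 3; the two decls are the same term). -/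
theorem FaceMaximiser_proof_longBlockAmortisation :
    Summit.MatrixMultiplication.MatrixMultiplication.Theses.LongBlockAmortisation.FaceMaximiser :=
  FaceMaximiser_of stub_faceAtTwo stub_convexLift

end Summit.MatrixMultiplication.MatrixMultiplication.Cruxes.FaceMaximiser.Birth
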